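import Literature.MathematicalPhysics.QuantumFieldTheory.Balaban1983to89.B1Eq324BenfattoClassTorusWindow
import Literature.MathematicalPhysics.QuantumFieldTheory.Balaban1983to89.B1Eq324BenfattoClassEntryFromCovarianceUniform
import HarnessLib

/-!
# `Balaban1983to89.B1Eq324BenfattoClassTorusWindowCovariance` — THE BENT WINDOW IN COVARIANCE CURRENCY: a Gaussian block on the torus given by
# its COVARIANCE `G` ([Balaban1985BackgroundPropagators] (3.157)–(3.158) p. 428 «bounds and uniform exponential decay for C^{(k)}(Λ)»;
# [Balaban1985UV3] p. 261 «a covariance having an exponential decay property») presented as a class member on a window of `ℤ^{2d+1}`, and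
# [Balaban1982Higgs1] (3.24) for it at every such covariance (∘ seat n08-w5's `…ClassEntryFromCovarianceUniform.eq324_covariance_of_expDecay`)

statement-level companion of a published source with citation tags; every declaration here is a theorem; nothing here is
a claim about the Yang–Mills mass gap

WHY THIS MODULE (cell `pub-ymgap`, seat `dag-n08-b` gen 14, INTENT-7; node N08 [Balaban1985UV3]).  `…ClassTorusWindow.exists_presentation_of_torusDecay`
presents a torus block given by its PRECISION (Sect. E's `C*Δ_kC`); the in-edge N06 may equally deliver the COVARIANCE side ((3.157): `C^{(k)}(Λ)`
symmetric, uniformly elliptic, bounded, exponentially decaying — the currency of seat n08-w5's `exists_classConsts_of_covarianceBounds` /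
`eq324_covariance_of_expDecay` on `ℤ^d`).  This file is the covariance twin of the torus kit: the re-indexed covariance `reindex e e G` keeps symmetry,
the LOWER and the UPPER form bounds, acquires Euclidean decay on the bent window, the class field `μ_K` with `K` = zero-extended `reindex e e G`
PRESENTS `𝒩(0, G)` under `z ↦ z ∘ e`, the boxes pull back a.e., and (3.24) follows for every such block by seat n08-w5's theorem on `ℤ^{2d+1}`.

WHAT IS PROVED (standard axioms; no `sorry`; no definition).
* §1 `reindex_form_le` (upper form bound inherited), `inv_reindex_inv_eq` (`(reindex e e G⁻¹)⁻¹ = reindex e e G`), ★ `map_restrictAlong_eq_cov`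
  (`(μ_K).map (z ↦ z ∘ e) = 𝒩(0, G)` for `K` = zero-extended `reindex e e G`), ★ `preimage_box_ae_eq_smallFieldSet_cov`.
* §2 ★★★ `exists_presentation_of_torusCovarianceDecay` — from `(site, lab)` injective and `G` symmetric, `g`-coercive, `Λ_G`-bounded with torus-metric
  decay: `∃ Λ ⊂ ℤ^{2d+1}, e : β ≃ ↥Λ` with `reindex e e G` symmetric, `g`-coercive, `Λ_G`-bounded, `|·| ≤ K e^{κm}·e^{−(κ/√(2d+1))|·|₂}`, the bridge and the box.
* §3 ★★★ `eq324_torusCovariance_of_expDecay` — (3.24) for EVERY such torus block: `∃ η₀ C` from the scalars `(d, g, Λ_G, K, κ, m, …)` alone, then for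
  every block a window, a bijection, the bridge, the box, and the (3.24) pair for all `η ≤ η₀` and all `(s, I ⊇ J, a)` with `J ⊆ Λ`, `coefSup ≤ c η^σ`.
HONEST SCOPE.  Composition by name (bent window + n08-w5's covariance entry + the class road); OUR class form and OUR device; which block
(`β`, `G`, labelling) presents [Balaban1985UV3]'s step and with which Hamiltonian letters is the IDENT — NOT commissioned, NOT claimed;
count-neutral for N08; nothing about d = 4, the continuum, OS axioms, a mass gap or the Clay problem.
-/

noncomputable section

open MeasureTheory Finset Matrix
open scoped BigOperators

namespace Literature.MathematicalPhysics.QuantumFieldTheory.Balaban1983to89.B1Eq324BenfattoClassTorusWindowCovariance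

open Literature.MathematicalPhysics.QuantumFieldTheory
open Literature.MathematicalPhysics.QuantumFieldTheory.Balaban1983to89.B1Eq324BenfattoLemma
open Literature.MathematicalPhysics.QuantumFieldTheory.Balaban1983to89.B1Eq324BenfattoClassAppendixC (posDef_of_coercive coercive_inv_of_form_le)
open Literature.MathematicalPhysics.QuantumFieldTheory.Balaban1983to89.B1Eq324BenfattoClassPresentation
  (reindex_entry reindex_symm reindex_coercive reindex_abs_le_exp_of_dist_le map_restrictAlong_eq preimage_box_ae_eq_smallFieldSet)
open Literature.MathematicalPhysics.QuantumFieldTheory.Balaban1983to89.B1Eq324BenfattoClassTorusWindow (exists_torusWindowLabelled)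
open Literature.MathematicalPhysics.QuantumFieldTheory.Balaban1983to89.B1Eq324BenfattoClassEntryFromCovarianceUniform
  (eq324_covariance_of_expDecay)

variable {d : ℕ} {β : Type*} [Fintype β] [DecidableEq β]

/-! ## §1  Re-indexing in covariance currency -/

section Reindex

variable {Λ : Finset (B1Eq324BenfattoLemma.Site d)} (e : β ≃ ↥Λ) {G : Matrix β β ℝ}

omit [DecidableEq β] in
/-- kernel: a symmetric coercive matrix on any finite index type is invertible. [folklore] -/
private theorem isUnit_det_of_coercive' [DecidableEq β] (hGs : ∀ b b', G b b' = G b' b) {g : ℝ} (hg0 : 0 < g)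
    (hg : ∀ v : β → ℝ, g * ∑ b, v b ^ 2 ≤ ∑ b, ∑ b', G b b' * v b * v b') : IsUnit G.det :=
  (Matrix.isUnit_iff_isUnit_det _).1 (posDef_of_coercive hGs hg0 hg).isUnit

/-- kernel: the inverse of a symmetric coercive matrix is symmetric. [folklore] -/
private theorem inv_symm' (hGs : ∀ b b', G b b' = G b' b) {g : ℝ} (hg0 : 0 < g)
    (hg : ∀ v : β → ℝ, g * ∑ b, v b ^ 2 ≤ ∑ b, ∑ b', G b b' * v b * v b') :
    ∀ b b', (G⁻¹ : Matrix β β ℝ) b b' = (G⁻¹ : Matrix β β ℝ) b' b := by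
  intro b b'
  have h := (posDef_of_coercive hGs hg0 hg).inv.isHermitian.apply b b'
  simpa using h.symm

omit [DecidableEq β] in
/-- **The upper form bound is inherited**: `Σ G v v ≤ Λ_G Σ v²` for all `v` gives the same for `reindex e e G`.
[cite: Balaban1985BackgroundPropagators, (3.157) p.428 «bounds … for C^{(k)}(Λ)» (class form; ours)] -/
theorem reindex_form_le {ΛG : ℝ} (hΛG : ∀ v : β → ℝ, ∑ b, ∑ b', G b b' * v b * v b' ≤ ΛG * ∑ b, v b ^ 2) :
    ∀ w : ↥Λ → ℝ, ∑ x, ∑ y, (Matrix.reindex e e G) x y * w x * w y ≤ ΛG * ∑ x, w x ^ 2 := by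
  intro w
  have h := hΛG (fun b => w (e b))
  have h1 : ∑ b, w (e b) ^ 2 = ∑ x, w x ^ 2 := e.sum_comp (fun x => w x ^ 2)
  have h2 : ∑ b, ∑ b', G b b' * w (e b) * w (e b') = ∑ x, ∑ y, (Matrix.reindex e e G) x y * w x * w y := by
    rw [← e.sum_comp (fun x => ∑ y, (Matrix.reindex e e G) x y * w x * w y)]
    refine Finset.sum_congr rfl fun b _ => ?_
    rw [← e.sum_comp (fun y => (Matrix.reindex e e G) (e b) y * w (e b) * w y)]
    refine Finset.sum_congr rfl fun b' _ => ?_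
    simp only [reindex_entry, Equiv.symm_apply_apply]
  rw [h1, h2] at h
  exact h

/-- **`(reindex e e G⁻¹)⁻¹ = reindex e e G`** for an invertible `G` (`Matrix.inv_reindex` + `(G⁻¹)⁻¹ = G`).
[cite: Balaban1985BackgroundPropagators, (3.158) p.428 (class form; ours)] -/
theorem inv_reindex_inv_eq (hG : IsUnit G.det) : (Matrix.reindex e e G⁻¹)⁻¹ = Matrix.reindex e e G := by
  rw [Matrix.inv_reindex, Matrix.nonsing_inv_nonsing_inv G hG]

variable {K : B1Eq324BenfattoLemma.Site d → B1Eq324BenfattoLemma.Site d → ℝ}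
  (hK : ∀ x y, K x y = if h : x ∈ Λ ∧ y ∈ Λ then (Matrix.reindex e e G : Matrix ↥Λ ↥Λ ℝ) ⟨x, h.1⟩ ⟨y, h.2⟩ else 0)

include hK

/-- kernel: in covariance currency the kernel is the zero-extension of `(reindex e e G⁻¹)⁻¹` (the `hK` shape of `…ClassPresentation` at `T := G⁻¹`).
[folklore] -/
private theorem hK_of_cov (hG : IsUnit G.det) :
    ∀ x y, K x y = if h : x ∈ Λ ∧ y ∈ Λ then ((Matrix.reindex e e G⁻¹)⁻¹ : Matrix ↥Λ ↥Λ ℝ) ⟨x, h.1⟩ ⟨y, h.2⟩ else 0 := by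
  intro x y
  rw [hK x y, inv_reindex_inv_eq e hG]

/-- ★ **THE GAUSSIAN BRIDGE IN COVARIANCE CURRENCY**: for `G` symmetric, `g`-coercive and `Λ_G`-bounded, `K` the zero-extended `reindex e e G`:
`(μ_K).map (z ↦ z ∘ e) = gaussianFieldOfKernel G` on `β → ℝ`. [cite: Balaban1985BackgroundPropagators, (3.157)–(3.158) p.428; BenfattoEtAl1978, §1 p.144 (class form; ours)] -/
theorem map_restrictAlong_eq_cov (hGs : ∀ b b', G b b' = G b' b) {g ΛG : ℝ} (hg0 : 0 < g) (hΛG0 : 0 < ΛG)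
    (hg : ∀ v : β → ℝ, g * ∑ b, v b ^ 2 ≤ ∑ b, ∑ b', G b b' * v b * v b')
    (hΛG : ∀ v : β → ℝ, ∑ b, ∑ b', G b b' * v b * v b' ≤ ΛG * ∑ b, v b ^ 2) :
    (gaussianFieldOfKernel K).map (fun (z : B1Eq324BenfattoLemma.Site d → ℝ) (b : β) => z ((e b : ↥Λ) : B1Eq324BenfattoLemma.Site d)) =
      gaussianFieldOfKernel fun b b' => G b b' := by
  have hGdet : IsUnit G.det := isUnit_det_of_coercive' hGs hg0 hg
  have h := map_restrictAlong_eq e (hK_of_cov e hK hGdet) (inv_symm' hGs hg0 hg) (one_div_pos.mpr hΛG0)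
    (fun v => coercive_inv_of_form_le hGs hg0 hg hΛG v)
  rw [Matrix.nonsing_inv_nonsing_inv G hGdet] at h
  exact h

/-- ★ **THE BOX IDENTITY IN COVARIANCE CURRENCY** (`p ≥ 0`): `Φ⁻¹'{ω | ∀ b, |ω b| ≤ p} =ᵐ[μ_K] smallFieldSet Λ p`.
[cite: BenfattoEtAl1978, (A.1) p.161; Balaban1985UV3, (18) p.260 (class form; ours)] -/
theorem preimage_box_ae_eq_smallFieldSet_cov (hGs : ∀ b b', G b b' = G b' b) {g ΛG : ℝ} (hg0 : 0 < g) (hΛG0 : 0 < ΛG)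
    (hg : ∀ v : β → ℝ, g * ∑ b, v b ^ 2 ≤ ∑ b, ∑ b', G b b' * v b * v b')
    (hΛG : ∀ v : β → ℝ, ∑ b, ∑ b', G b b' * v b * v b' ≤ ΛG * ∑ b, v b ^ 2) {p : ℝ} (hp : 0 ≤ p) :
    ((fun (z : B1Eq324BenfattoLemma.Site d → ℝ) (b : β) => z ((e b : ↥Λ) : B1Eq324BenfattoLemma.Site d)) ⁻¹' {ω : β → ℝ | ∀ b, |ω b| ≤ p})
      =ᵐ[gaussianFieldOfKernel K] smallFieldSet Λ p :=
  preimage_box_ae_eq_smallFieldSet e (hK_of_cov e hK (isUnit_det_of_coercive' hGs hg0 hg)) (inv_symm' hGs hg0 hg)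
    (one_div_pos.mpr hΛG0) (fun v => coercive_inv_of_form_le hGs hg0 hg hΛG v) hp

end Reindex

/-! ## §2  The torus covariance kit -/

/-- ★★★ **THE TORUS COVARIANCE KIT** — variables `β` with torus sites `site : β → (ℤ/N)^d` (`d ≥ 1`), labels `lab : β → Fin m`, `(site, lab)` injective;
a covariance `G : Matrix β β ℝ` symmetric, `g`-coercive, `Λ_G`-bounded, decaying `|G b b′| ≤ K e^{−κ ρ(b,b′)}` for a `ρ` dominating the torus
sup-distance of the sites.  THEN there are a window `Λ ⊂ ℤ^{2d+1}` and a bijection `e : β ≃ ↥Λ` with: `reindex e e G` symmetric, `g`-coercive,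
`Λ_G`-bounded, Euclidean decay `K e^{κm}·e^{−(κ/√(2d+1))|x−y|₂}`; the class field of the zero-extended `reindex e e G` presents `𝒩(0, G)`; the boxes
pull back a.e. — the hypotheses of seat n08-w5's `eq324_covariance_of_expDecay` on `ℤ^{2d+1}` for this member.
[cite: Balaban1985BackgroundPropagators, (3.157)–(3.158) p.428; Balaban1985UV3, p.261 «a covariance having an exponential decay property», (58) p.270
(class form; the bent window is ours)] -/
theorem exists_presentation_of_torusCovarianceDecay {N : ℕ} (m : ℕ) [NeZero N] (hd : 0 < d)
    (site : β → Fin d → ZMod N) (lab : β → Fin m) (hinj : Function.Injective fun b => (site b, lab b))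
    {G : Matrix β β ℝ} (hGs : ∀ b b', G b b' = G b' b) {g ΛG : ℝ} (hg0 : 0 < g) (hΛG0 : 0 < ΛG)
    (hg : ∀ v : β → ℝ, g * ∑ b, v b ^ 2 ≤ ∑ b, ∑ b', G b b' * v b * v b')
    (hΛG : ∀ v : β → ℝ, ∑ b, ∑ b', G b b' * v b * v b' ≤ ΛG * ∑ b, v b ^ 2)
    {K κ : ℝ} {ρ : β → β → ℝ} (hK : 0 ≤ K) (hκ : 0 ≤ κ) (hdec : ∀ b b', |G b b'| ≤ K * Real.exp (-(κ * ρ b b')))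
    (hρ : ∀ b b' i, (|((site b i - site b' i).valMinAbs : ℤ)| : ℝ) ≤ ρ b b') :
    ∃ (Λ : Finset (B1Eq324BenfattoLemma.Site (d + d + 1))) (e : β ≃ ↥Λ),
      (∀ x y : ↥Λ, (Matrix.reindex e e G) x y = (Matrix.reindex e e G) y x) ∧
      (∀ w : ↥Λ → ℝ, g * ∑ x, w x ^ 2 ≤ ∑ x, ∑ y, (Matrix.reindex e e G) x y * w x * w y) ∧
      (∀ w : ↥Λ → ℝ, ∑ x, ∑ y, (Matrix.reindex e e G) x y * w x * w y ≤ ΛG * ∑ x, w x ^ 2) ∧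
      (∀ x y : ↥Λ, |(Matrix.reindex e e G) x y| ≤ K * Real.exp (κ * m) * Real.exp (-(κ / Real.sqrt (d + d + 1) *
        Real.sqrt (∑ j, ((((x : B1Eq324BenfattoLemma.Site (d + d + 1)) j : ℝ) - ((y : B1Eq324BenfattoLemma.Site (d + d + 1)) j : ℝ))) ^ 2)))) ∧
      ((gaussianFieldOfKernel fun x y => if h : x ∈ Λ ∧ y ∈ Λ then (Matrix.reindex e e G : Matrix ↥Λ ↥Λ ℝ) ⟨x, h.1⟩ ⟨y, h.2⟩ else 0).map
          (fun (z : B1Eq324BenfattoLemma.Site (d + d + 1) → ℝ) (b : β) => z ((e b : ↥Λ) : B1Eq324BenfattoLemma.Site (d + d + 1))) =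
        gaussianFieldOfKernel fun b b' => G b b') ∧
      (∀ p : ℝ, 0 ≤ p →
        ((fun (z : B1Eq324BenfattoLemma.Site (d + d + 1) → ℝ) (b : β) => z ((e b : ↥Λ) : B1Eq324BenfattoLemma.Site (d + d + 1))) ⁻¹'
            {ω : β → ℝ | ∀ b, |ω b| ≤ p}) =ᵐ[gaussianFieldOfKernel fun x y =>
              if h : x ∈ Λ ∧ y ∈ Λ then (Matrix.reindex e e G : Matrix ↥Λ ↥Λ ℝ) ⟨x, h.1⟩ ⟨y, h.2⟩ else 0] smallFieldSet Λ p) := by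
  classical
  obtain ⟨ι, hι, hdist⟩ := exists_torusWindowLabelled d N m
  set f : β → B1Eq324BenfattoLemma.Site (d + d + 1) := fun b => ι (site b, lab b) with hf
  have hfinj : Function.Injective f := fun b b' h => hinj (hι h)
  let Λ : Finset (B1Eq324BenfattoLemma.Site (d + d + 1)) := Finset.univ.image f
  have hmem : ∀ b, f b ∈ Λ := fun b => Finset.mem_image_of_mem f (Finset.mem_univ b)
  let e : β ≃ ↥Λ := Equiv.ofBijective (fun b => ⟨f b, hmem b⟩)
    ⟨fun b b' h => hfinj (Subtype.ext_iff.mp h), fun x => by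
      obtain ⟨b, -, hb⟩ := Finset.mem_image.mp x.2
      exact ⟨b, Subtype.ext hb⟩⟩
  have he : ∀ b, ((e b : ↥Λ) : B1Eq324BenfattoLemma.Site (d + d + 1)) = ι (site b, lab b) := fun b => rfl
  refine ⟨Λ, e, reindex_symm e hGs, reindex_coercive e hg, reindex_form_le e hΛG, ?_,
    map_restrictAlong_eq_cov e (fun x y => rfl) hGs hg0 hΛG0 hg hΛG,
    fun p hp => preimage_box_ae_eq_smallFieldSet_cov e (fun x y => rfl) hGs hg0 hΛG0 hg hΛG hp⟩
  -- Euclidean decay on the bent window (as in `…ClassTorusWindow` §5)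
  have hC₁ : 0 < Real.sqrt (d + d + 1) := Real.sqrt_pos.mpr (by positivity)
  have hD : ∀ b b', Real.sqrt (∑ j, (((((e b : ↥Λ) : B1Eq324BenfattoLemma.Site (d + d + 1)) j : ℝ) -
      (((e b' : ↥Λ) : B1Eq324BenfattoLemma.Site (d + d + 1)) j : ℝ))) ^ 2) ≤ Real.sqrt (d + d + 1) * ρ b b' + Real.sqrt (d + d + 1) * m := by
    intro b b'
    let M : ℤ := Finset.univ.sup' ⟨⟨0, hd⟩, Finset.mem_univ _⟩ fun i => |((site b i - site b' i).valMinAbs : ℤ)|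
    have hMi : ∀ i, |((site b i - site b' i).valMinAbs : ℤ)| ≤ M := fun i =>
      Finset.le_sup' (fun i => |((site b i - site b' i).valMinAbs : ℤ)|) (Finset.mem_univ i)
    have hM0 : 0 ≤ M := (abs_nonneg _).trans (hMi ⟨0, hd⟩)
    have hMρ : (M : ℝ) ≤ ρ b b' := by
      obtain ⟨i₀, -, hi₀⟩ := Finset.exists_mem_eq_sup' ⟨⟨0, hd⟩, Finset.mem_univ _⟩ fun i => |((site b i - site b' i).valMinAbs : ℤ)|
      have : (M : ℝ) = (|((site b i₀ - site b' i₀).valMinAbs : ℤ)| : ℝ) := by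
        rw [show M = |((site b i₀ - site b' i₀).valMinAbs : ℤ)| from hi₀, Int.cast_abs]
      rw [this]
      exact hρ b b' i₀
    have h := (hdist (site b) (site b') (lab b) (lab b') M hM0 hMi).2
    simp only [he]
    refine h.trans ?_
    have hmax : max (M : ℝ) (m : ℝ) ≤ ρ b b' + m :=
      max_le (by linarith [(Nat.cast_nonneg m : (0 : ℝ) ≤ m)]) (by linarith [(by exact_mod_cast hM0 : (0 : ℝ) ≤ M)])
    calc Real.sqrt (d + d + 1) * max (M : ℝ) (m : ℝ) ≤ Real.sqrt (d + d + 1) * (ρ b b' + m) := mul_le_mul_of_nonneg_left hmax hC₁.le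
      _ = _ := by ring
  have hdec' := reindex_abs_le_exp_of_dist_le e hK hκ hC₁ hdec hD
  intro x y
  have h := hdec' x y
  have hconst : κ * (Real.sqrt (d + d + 1) * m) / Real.sqrt (d + d + 1) = κ * m := by field_simp
  rw [hconst] at h
  exact h

/-! ## §3  (3.24) for every such torus block, by seat n08-w5's covariance entry on `ℤ^{2d+1}` -/

/-- ★★★ **[Balaban1982Higgs1] (3.24) FOR A TORUS BLOCK GIVEN BY ITS COVARIANCE** — for `d ≥ 1`, scalars `g > 0`, `Λ_G > 0`, `K ≥ 0`, `κ > 0`, a label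
count `m`, every `t D`, `ϰ > 0`, `b₀ > 0`, `p₀ > 2/3`, `σ > 0`, `c ≥ 0`, `0 < κ′ < σ(t+1)`: there are `η₀ ∈ (0,1]`, `C ≥ 0` (from these scalars ALONE) such
that for EVERY `N ≥ 1`, every variables `β` labelled injectively by `(site, lab)`, every covariance `G` (symmetric, `g`-coercive, `Λ_G`-bounded,
torus-metric decay `K e^{−κρ}`) there are a window `Λ ⊂ ℤ^{2d+1}` and `e : β ≃ ↥Λ` with the Gaussian bridge, the a.e. box identity, and, for all
`η ≤ η₀` and `(s, I ⊇ J, a)` with `I ≠ ∅`, `J ⊆ Λ`, `coefSup ≤ c·η^σ`, the (3.24) pair for the class field `μ_K` (`K` = zero-extended `reindex e e G`).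
[cite: Balaban1982Higgs1, (3.24) p.616; BenfattoEtAl1978, Lemma (4.5)–(4.7) p.152; Balaban1985BackgroundPropagators, (3.157)–(3.158) p.428;
Balaban1985UV3, (58) p.270, p.261 (class form; the bent window is ours)] -/
theorem eq324_torusCovariance_of_expDecay [Nonempty β] (m : ℕ) (hd : 0 < d) {g ΛG KG κG : ℝ} (hg0 : 0 < g) (hΛG0 : 0 < ΛG) (hKG : 0 ≤ KG) (hκG : 0 < κG)
    (t D : ℕ) {ϰ : ℝ} (hϰ : 0 < ϰ) {b₀ p₀ σ c κ : ℝ} (hb₀ : 0 < b₀) (hp₀ : 2 / 3 < p₀) (hσ : 0 < σ) (hc : 0 ≤ c) (hκ : 0 < κ)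
    (hκσ : κ < σ * (t + 1)) :
    ∃ η₀ C : ℝ, 0 < η₀ ∧ η₀ ≤ 1 ∧ 0 ≤ C ∧
      ∀ {N : ℕ} [NeZero N] (site : β → Fin d → ZMod N) (lab : β → Fin m), (Function.Injective fun b => (site b, lab b)) →
      ∀ {G : Matrix β β ℝ} {ρ : β → β → ℝ}, (∀ b b', G b b' = G b' b) →
        (∀ v : β → ℝ, g * ∑ b, v b ^ 2 ≤ ∑ b, ∑ b', G b b' * v b * v b') →
        (∀ v : β → ℝ, ∑ b, ∑ b', G b b' * v b * v b' ≤ ΛG * ∑ b, v b ^ 2) →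
        (∀ b b', |G b b'| ≤ KG * Real.exp (-(κG * ρ b b'))) →
        (∀ b b' i, (|((site b i - site b' i).valMinAbs : ℤ)| : ℝ) ≤ ρ b b') →
      ∃ (Λ : Finset (B1Eq324BenfattoLemma.Site (d + d + 1))) (e : β ≃ ↥Λ),
        ((gaussianFieldOfKernel fun x y => if h : x ∈ Λ ∧ y ∈ Λ then (Matrix.reindex e e G : Matrix ↥Λ ↥Λ ℝ) ⟨x, h.1⟩ ⟨y, h.2⟩ else 0).map
            (fun (z : B1Eq324BenfattoLemma.Site (d + d + 1) → ℝ) (b : β) => z ((e b : ↥Λ) : B1Eq324BenfattoLemma.Site (d + d + 1))) =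
          gaussianFieldOfKernel fun b b' => G b b') ∧
        (∀ p : ℝ, 0 ≤ p →
          ((fun (z : B1Eq324BenfattoLemma.Site (d + d + 1) → ℝ) (b : β) => z ((e b : ↥Λ) : B1Eq324BenfattoLemma.Site (d + d + 1))) ⁻¹'
              {ω : β → ℝ | ∀ b, |ω b| ≤ p}) =ᵐ[gaussianFieldOfKernel fun x y =>
                if h : x ∈ Λ ∧ y ∈ Λ then (Matrix.reindex e e G : Matrix ↥Λ ↥Λ ℝ) ⟨x, h.1⟩ ⟨y, h.2⟩ else 0] smallFieldSet Λ p) ∧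
        ∀ η : ℝ, 0 < η → η ≤ η₀ →
          ∀ (s : ℕ) (I J : Finset (B1Eq324BenfattoLemma.Site (d + d + 1))) (a : Coef (d + d + 1)), I.Nonempty → J ⊆ I → J ⊆ Λ →
            coefSup s D a J ≤ c * η ^ σ →
            0 < ∫ z, cutoffBoltzmann (hamiltonian s D ϰ a J) I (B10.pFun b₀ p₀ η) z ∂(gaussianFieldOfKernel fun x y =>
                if h : x ∈ Λ ∧ y ∈ Λ then (Matrix.reindex e e G : Matrix ↥Λ ↥Λ ℝ) ⟨x, h.1⟩ ⟨y, h.2⟩ else 0) ∧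
              |Real.log (∫ z, cutoffBoltzmann (hamiltonian s D ϰ a J) I (B10.pFun b₀ p₀ η) z ∂(gaussianFieldOfKernel fun x y =>
                  if h : x ∈ Λ ∧ y ∈ Λ then (Matrix.reindex e e G : Matrix ↥Λ ↥Λ ℝ) ⟨x, h.1⟩ ⟨y, h.2⟩ else 0)) -
                cumulantSum (gaussianFieldOfKernel fun x y =>
                  if h : x ∈ Λ ∧ y ∈ Λ then (Matrix.reindex e e G : Matrix ↥Λ ↥Λ ℝ) ⟨x, h.1⟩ ⟨y, h.2⟩ else 0)
                  (hamiltonian s D ϰ a J) t| ≤ C * η ^ κ * I.card := by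
  -- seat n08-w5's covariance (3.24) on `ℤ^{2d+1}` with the bent-window constants `(g, Λ_G, K e^{κ m}, κ/√(2d+1))`
  have hd' : 0 < d + d + 1 := by omega
  have hKG' : 0 ≤ KG * Real.exp (κG * m) := by positivity
  have hκG' : 0 < κG / Real.sqrt (d + d + 1) := div_pos hκG (Real.sqrt_pos.mpr (by positivity))
  obtain ⟨η₀, C, hη₀, hη₀1, hC, hE⟩ :=
    eq324_covariance_of_expDecay (d := d + d + 1) hd' hg0 hΛG0 hKG' hκG' t D hϰ hb₀ hp₀ hσ hc hκ hκσ
  refine ⟨η₀, C, hη₀, hη₀1, hC, ?_⟩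
  intro N _ site lab hinj G ρ hGs hg hΛG hdec hρ
  obtain ⟨Λ, e, hsymm, hcoer, hform, hdec', hmap, hbox⟩ :=
    exists_presentation_of_torusCovarianceDecay m hd site lab hinj hGs hg0 hΛG0 hg hΛG hKG hκG.le hdec hρ
  refine ⟨Λ, e, hmap, hbox, fun η hη hηle s I J a hI hJI hJΛ hA => ?_⟩
  have hΛ : Λ.Nonempty := ⟨_, (e (Classical.choice ‹Nonempty β›)).2⟩
  exact hE η hη hηle (fun x y => rfl) hΛ hsymm hcoer hform hdec' s I J a hI hJI hJΛ hA

end Literature.MathematicalPhysics.QuantumFieldTheory.Balaban1983to89.B1Eq324BenfattoClassTorusWindowCovariance
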